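import Summits.ResolutionOfSingularities.ResolutionOfSingularities.Theorems.EquisingularLiftEquisingularLiftNatTowerCechRootCentre
import Summits.ResolutionOfSingularities.ResolutionOfSingularities.Theorems.EquisingularLiftEquisingularLiftNatDirectionSections
import Summits.ResolutionOfSingularities.ResolutionOfSingularities.Theorems.EquisingularLiftEquisingularLiftNatDirectionLiftGlue
import Summits.ResolutionOfSingularities.ResolutionOfSingularities.Theorems.EquisingularLiftEquisingularLiftNatProportionalCocycle
import Summits.ResolutionOfSingularities.ResolutionOfSingularities.Theorems.EquisingularLiftEquisingularLiftNatP1VBPackage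
import Summits.ResolutionOfSingularities.ResolutionOfSingularities.Theorems.EquisingularLiftEquisingularLiftNatDirectionOfChartColumns
import Summits.ResolutionOfSingularities.ResolutionOfSingularities.Theorems.EquisingularLiftEquisingularLiftNatCentreRegularImmersion
import Summits.ResolutionOfSingularities.ResolutionOfSingularities.Theorems.EquisingularLiftEquisingularLiftNatCentreCodimOfFrames
import Summits.ResolutionOfSingularities.ResolutionOfSingularities.Theorems.EquisingularLiftEquisingularLiftNatRationalCarrierLift
import Literature.AlgebraicGeometry.Motives.ProjBaseChangeAny
import Summits.ResolutionOfSingularities.ResolutionOfSingularities.Theorems.EquisingularLiftEquisingularLiftNatDirLiftRingCores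
import HarnessLib

/-!
# [OURS · L1 W4.5(b) · S6 (L) brick C3⁺ (C3-iii)] Two lifted direction columns agree modulo `I²` at the stalks

Cell res-hironaka, LADDER-RESOLUTION rung L, slot W4.5(b), crux chain w45b: EL♮(3) = stmt-ResolutionOfSingularities-20148; the door at n = 3
(coneTower / ratNoseTower / ratDirZero) hinges on the direction-lift socket (L) `hL` (res-L1-w45b-stub-4 g9 `Tower.hLift_of_bricks`, skeleton
`L/res-L1-w45b-stub-4/DirLiftSkeleton-v2.lean` db5114efb4ea3c7d); THIS FILE = brick **(C3-iii)** `dirLift_chartColumn_compat`, signature VERBATIM from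
the skeleton l.77–107 (binder `hfr` unused here, spelled `_hfr`; type unchanged). res-L1-w45b-lead-2 g3 (TAKING 23:21:50Z; res-D-pv-035 declined the
Modules half honestly and supplied the ring-core idea; ring cores of res-D-pv-036 p584571 used). `--supports stmt-ResolutionOfSingularities-20148 --as helper`.
NOT a statement of any manuscript; OURS; AI-written, weaker than expert review. No `sorry`; standard axioms; DEF-FREE.

THEOREM. Two point-packages `(V, x, s, eV, A, W, κ)`, `(V', x', s', eV', A', W', κ')` of the direction lift — conormal chart frames `eV`, `eV'`
reading to generators `x`, `x'` of `I` on affine `V`, `V'`; coordinates `A`, `A'` of the image under `σ : K → e⁻¹*𝒞` of the local generator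
`b^κ`, `b^κ'` of the line bundle `K` in the pulled-back frames — give the same direction germ at every `p ∈ V ∩ V'`:
`(Σ A_j x_j) + I_p² = (Σ A'_j x'_j) + I_p²`.

PROOF. Off `Supp I` both sides are `⊤`. At `p ∈ Supp I`: on an affine `V″ ∋ p` below `V ∩ V'` write `x'_j = Σ_l N_jl x_l`
(res-D-pv-051 `exists_changeOfGenerators`), so the pulled-back conormal frames satisfy `b'_j = Σ_l N̄_jl b_l` over `Ω = e⁻¹ι⁻¹V″`
(`map_unitSection_eq_sum` twice, as in 051's `map_basisSection_eq_sum_of_changeOfGenerators`); the two generators of `K` differ on `Ω` by the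
unit transition `t` (`b^κ'| = t b^κ|`, `t t' = 1`); applying `σ` (naturality, linearity) and reading coordinates in the frame `(b_l)`
(`coord_sum_smul_basisSection`) gives `t Ā_l = Σ_j Ā'_j N̄_jl` on `Ω`; lifting `t, t'` to `T, T' ∈ Γ(V″)` through the surjection
`(e⁻¹ ≫ ι)♯ : Γ(V″) ↠ Γ(Ω)` (Mathlib `subschemeι_app_surjective`; kernel `I(V″)` by `ker_subschemeι_app`) gives
`Σ_j A'_j N_jl − T A_l ∈ I(V″)` and `T T' − 1 ∈ I(V″)`; at the stalk, `germ T` is a unit (`I_p ≤ 𝔪_p`, res-D-pv-036 `isUnit_of_mul_sub_one_mem`)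
and `span_sum_mul_sup_sq_eq` (res-D-pv-036 p584571) closes.
-/

set_option linter.dupNamespace false
set_option linter.overlappingInstances false

noncomputable section

-- `TopCat.Presheaf`/`Scheme.Modules` are not reducible (as in Mathlib's `AlgebraicGeometry/Modules`).
set_option backward.isDefEq.respectTransparency false

open CategoryTheory CategoryTheory.Limits AlgebraicGeometry TopologicalSpace Topology IsLocalRing Opposite
open Literature.AlgebraicGeometry.Resolution
open Literature.AlgebraicGeometry.Morphisms (ProjCech.PP ProjCech.toSpec)
open Literature.AlgebraicGeometry.Modules Literature.AlgebraicGeometry.Motives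
open Literature.AlgebraicGeometry.Deformation Literature.AlgebraicGeometry.HodgeTheory
open AlgebraicGeometry.Scheme.IdealSheafData
open Summit.ResolutionOfSingularities.ResolutionOfSingularities.Theses.EquisingularLift.Split
open Summit.ResolutionOfSingularities.ResolutionOfSingularities.Cruxes.EquisingularLift.StrataSplit


namespace Summit.ResolutionOfSingularities.ResolutionOfSingularities.Cruxes.EquisingularLiftNat.Sections

open Summit.ResolutionOfSingularities.ResolutionOfSingularities.Cruxes.EquisingularLiftNat.P1VB

/-! ## (C3-iii) two lifted columns agree modulo `I²` at the stalks -/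

set_option maxHeartbeats 400000 in
/-- **(C3-iii) two lifted columns agree modulo `I²` at the stalks.** Two point-packages `(V, x, s, eV, A, W, κ)`, `(V', x', s', eV', A', W', κ')`
of the direction lift (conormal chart frames reading to generators `x`, `x'` of `I`, coordinates `A`, `A'` of the image under `σ` of the local
generator of `K` in the pulled-back frames) give the same direction germ `(Σ A_j x_j) + I_p² = (Σ A'_j x'_j) + I_p²` at every `p ∈ V ∩ V'`.
PROOF. Off `Supp I` both sides are `⊤`. At `p ∈ Supp I`: on an affine `V″ ∋ p` below `V ∩ V'` write `x'_j = Σ_l N_jl x_l`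
(`exists_changeOfGenerators`), so the pulled-back conormal frames satisfy `b'_j = Σ_l N̄_jl b_l` over `Ω = e⁻¹ι⁻¹V″`; the two generators of
`K` differ there by a unit `t` (`b^κ'| = t b^κ|`); applying `σ` and comparing coordinates in the frame `(b_l)` gives `t Ā_l = Σ_j N̄_jl Ā'_j`
on `Ω`; lifting `t` to `T ∈ Γ(V″)` through the surjection `Γ(V″) ↠ Γ(Ω)` with kernel `I(V″)` gives `T A_l − Σ_j N_jl A'_j ∈ I(V″)` and
`T T' − 1 ∈ I(V″)`, whence `T (Σ A_l x_l) − Σ A'_j x'_j ∈ I(V″)²` with `T` a unit at `p` (ring cores of res-D-pv-036 p584571). [OURS] -/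
theorem dirLift_chartColumn_compat {X₀ Y : Scheme.{0}} [IsLocallyNoetherian X₀] (I : X₀.IdealSheafData)
    (_hfr : ∀ x ∈ I.support, ∃ c : Fin 2 → X₀.presheaf.stalk x, Ideal.span (Set.range c) = stalkIdeal I x ∧ IsQuasiRegular c)
    (e : I.subscheme ≅ Y) (K : Y.Modules)
    (σ : K ⟶ (Scheme.Modules.pullback e.inv).obj (conormalSheaf I.subschemeι))
    -- package 1
    (V : X₀.affineOpens) (x : Fin 2 → Γ(X₀, (V : X₀.Opens))) (s : Fin 2 → Γ(idealModule I.subschemeι, (V : X₀.Opens)))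
    (hgen : Ideal.span (Set.range x) = I.ideal V) (hs : ∀ j, toRing (idealModuleι I.subschemeι) (V : X₀.Opens) (s j) = x j)
    (eV : SheafOfModules.free (Fin 2) ≅ (conormalSheaf I.subschemeι).over (I.subschemeι ⁻¹ᵁ (V : X₀.Opens)))
    (heV : ∀ j, basisSection eV j = unitSectionLE I.subschemeι (idealModule I.subschemeι) (le_refl _) (s j))
    (A : Fin 2 → Γ(X₀, (V : X₀.Opens))) (W : Y.Opens) (κ : SheafOfModules.free (Fin 1) ≅ K.over W)
    (hVW : e.inv ⁻¹ᵁ (I.subschemeι ⁻¹ᵁ (V : X₀.Opens)) ≤ W)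
    (hlink : ((Scheme.Modules.pullback e.inv).obj (conormalSheaf I.subschemeι)).presheaf.map (homOfLE hVW).op
        (σ.app W (basisSection κ 0)) =
      ∑ j, e.inv.app _ (I.subschemeι.app (V : X₀.Opens) (A j)) •
        basisSection (E := (Scheme.Modules.pullback e.inv).obj (conormalSheaf I.subschemeι)) (pullbackFrame e.inv eV) j)
    -- package 2
    (V' : X₀.affineOpens) (x' : Fin 2 → Γ(X₀, (V' : X₀.Opens))) (s' : Fin 2 → Γ(idealModule I.subschemeι, (V' : X₀.Opens)))
    (hgen' : Ideal.span (Set.range x') = I.ideal V') (hs' : ∀ j, toRing (idealModuleι I.subschemeι) (V' : X₀.Opens) (s' j) = x' j)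
    (eV' : SheafOfModules.free (Fin 2) ≅ (conormalSheaf I.subschemeι).over (I.subschemeι ⁻¹ᵁ (V' : X₀.Opens)))
    (heV' : ∀ j, basisSection eV' j = unitSectionLE I.subschemeι (idealModule I.subschemeι) (le_refl _) (s' j))
    (A' : Fin 2 → Γ(X₀, (V' : X₀.Opens))) (W' : Y.Opens) (κ' : SheafOfModules.free (Fin 1) ≅ K.over W')
    (hVW' : e.inv ⁻¹ᵁ (I.subschemeι ⁻¹ᵁ (V' : X₀.Opens)) ≤ W')
    (hlink' : ((Scheme.Modules.pullback e.inv).obj (conormalSheaf I.subschemeι)).presheaf.map (homOfLE hVW').op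
        (σ.app W' (basisSection κ' 0)) =
      ∑ j, e.inv.app _ (I.subschemeι.app (V' : X₀.Opens) (A' j)) •
        basisSection (E := (Scheme.Modules.pullback e.inv).obj (conormalSheaf I.subschemeι)) (pullbackFrame e.inv eV') j)
    (p : X₀) (hp : p ∈ (V : X₀.Opens)) (hp' : p ∈ (V' : X₀.Opens)) :
    Ideal.span {(X₀.presheaf.germ (V : X₀.Opens) p hp).hom (∑ j, A j * x j)} ⊔ stalkIdeal I p ^ 2 =
      Ideal.span {(X₀.presheaf.germ (V' : X₀.Opens) p hp').hom (∑ j, A' j * x' j)} ⊔ stalkIdeal I p ^ 2 := by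
  classical
  by_cases hpI : p ∈ I.support
  swap
  · -- off the support both sides are `⊤`
    have htop : stalkIdeal I p = ⊤ := not_not.mp ((mem_support_iff_stalkIdeal_ne_top I p).not.mp hpI)
    rw [htop, pow_two, Ideal.top_mul, sup_top_eq, sup_top_eq]
  -- an affine `V'' ∋ p` below `V ∩ V'`
  obtain ⟨V''o, hV''aff, hpV'', hV''le⟩ :=
    exists_isAffineOpen_mem_and_subset (X := X₀) (x := p) (U := (V : X₀.Opens) ⊓ (V' : X₀.Opens)) ⟨hp, hp'⟩
  let V'' : X₀.affineOpens := ⟨V''o, hV''aff⟩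
  have h : (V'' : X₀.Opens) ≤ V := fun q hq => (hV''le hq).1
  have h' : (V'' : X₀.Opens) ≤ V' := fun q hq => (hV''le hq).2
  -- change of generators on `V''`
  obtain ⟨N, hN⟩ := P1VB.exists_changeOfGenerators I h h' x x' hgen hgen'
  -- STEP 1: the pulled-back conormal frames: `b'_j| = Σ_l N̄_jl • b_l|` over `Ω := e⁻¹ ι⁻¹ V''`
  have hsrel : ∀ j, (idealModule I.subschemeι).presheaf.map (homOfLE h').op (s' j) =
      ∑ l, N j l • (idealModule I.subschemeι).presheaf.map (homOfLE h).op (s l) := fun j => by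
    apply kernel_ι_app_injective (structureModuleMap I.subschemeι) (V'' : X₀.Opens)
    change toRing (idealModuleι I.subschemeι) (V'' : X₀.Opens) _ = toRing (idealModuleι I.subschemeι) (V'' : X₀.Opens) _
    rw [← map_toRing, hs']
    change secRes X₀ h' (x' j) = ((idealModuleι I.subschemeι).app (V'' : X₀.Opens)).hom (∑ l, N j l • _)
    rw [map_sum, hN]
    refine Finset.sum_congr rfl fun l _ => ?_
    change _ = toRing (idealModuleι I.subschemeι) (V'' : X₀.Opens) (N j l • _)
    rw [toRing_smul, ← map_toRing, hs]
  have R1' : ∀ j, (conormalSheaf I.subschemeι).presheaf.map ((Opens.map I.subschemeι.base).map (homOfLE h')).op (basisSection eV' j) =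
      ∑ l, I.subschemeι.app (V'' : X₀.Opens) (N j l) • (conormalSheaf I.subschemeι).presheaf.map ((Opens.map I.subschemeι.base).map (homOfLE h)).op (basisSection eV l) := fun j => by
    have R1 := map_unitSection_eq_sum I.subschemeι (idealModule I.subschemeι) (homOfLE h) (homOfLE h') s (s' j) (N j) (hsrel j)
    rw [P1VB.map_basisSection_conormalFrame I s' eV' heV', R1]
    refine Finset.sum_congr rfl fun l _ => ?_
    rw [P1VB.map_basisSection_conormalFrame I s eV heV]
  have R2 : ∀ j, ((Scheme.Modules.pullback e.inv).obj (conormalSheaf I.subschemeι)).presheaf.map ((Opens.map e.inv.base).map ((Opens.map I.subschemeι.base).map (homOfLE h'))).op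
      (basisSection (E := (Scheme.Modules.pullback e.inv).obj (conormalSheaf I.subschemeι)) (pullbackFrame e.inv eV') j) =
      ∑ l, e.inv.app _ (I.subschemeι.app (V'' : X₀.Opens) (N j l)) •
        ((Scheme.Modules.pullback e.inv).obj (conormalSheaf I.subschemeι)).presheaf.map ((Opens.map e.inv.base).map ((Opens.map I.subschemeι.base).map (homOfLE h))).op
          (basisSection (E := (Scheme.Modules.pullback e.inv).obj (conormalSheaf I.subschemeι)) (pullbackFrame e.inv eV) l) := fun j => by
    have R := map_unitSection_eq_sum e.inv (conormalSheaf I.subschemeι) ((Opens.map I.subschemeι.base).map (homOfLE h)) ((Opens.map I.subschemeι.base).map (homOfLE h'))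
      (basisSection eV) (basisSection eV' j) _ (R1' j)
    simp_rw [← basisSection_pullbackFrame] at R
    exact R
  -- the open `Ω` and the restriction maps
  have kΩV : e.inv ⁻¹ᵁ (I.subschemeι ⁻¹ᵁ (V'' : X₀.Opens)) ⟶ e.inv ⁻¹ᵁ (I.subschemeι ⁻¹ᵁ (V : X₀.Opens)) := (Opens.map e.inv.base).map ((Opens.map I.subschemeι.base).map (homOfLE h))
  have kΩV' : e.inv ⁻¹ᵁ (I.subschemeι ⁻¹ᵁ (V'' : X₀.Opens)) ⟶ e.inv ⁻¹ᵁ (I.subschemeι ⁻¹ᵁ (V' : X₀.Opens)) := (Opens.map e.inv.base).map ((Opens.map I.subschemeι.base).map (homOfLE h'))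
  have kΩW : e.inv ⁻¹ᵁ (I.subschemeι ⁻¹ᵁ (V'' : X₀.Opens)) ⟶ W := kΩV ≫ homOfLE hVW
  have kΩW' : e.inv ⁻¹ᵁ (I.subschemeι ⁻¹ᵁ (V'' : X₀.Opens)) ⟶ W' := kΩV' ≫ homOfLE hVW'
  -- abbreviations: restricted frame sections and coefficients on `Ω`
  set b : Fin 2 → Γ((Scheme.Modules.pullback e.inv).obj (conormalSheaf I.subschemeι), e.inv ⁻¹ᵁ (I.subschemeι ⁻¹ᵁ (V'' : X₀.Opens))) := fun l => ((Scheme.Modules.pullback e.inv).obj (conormalSheaf I.subschemeι)).presheaf.map kΩV.op (basisSection (E := (Scheme.Modules.pullback e.inv).obj (conormalSheaf I.subschemeι)) (pullbackFrame e.inv eV) l) with hbdef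
  set ā : Fin 2 → Γ(Y, e.inv ⁻¹ᵁ (I.subschemeι ⁻¹ᵁ (V'' : X₀.Opens))) := fun l => Y.presheaf.map kΩV.op (e.inv.app _ (I.subschemeι.app (V : X₀.Opens) (A l))) with hādef
  set ā' : Fin 2 → Γ(Y, e.inv ⁻¹ᵁ (I.subschemeι ⁻¹ᵁ (V'' : X₀.Opens))) := fun j => Y.presheaf.map kΩV'.op (e.inv.app _ (I.subschemeι.app (V' : X₀.Opens) (A' j))) with hā'def
  set Nb : Fin 2 → Fin 2 → Γ(Y, e.inv ⁻¹ᵁ (I.subschemeι ⁻¹ᵁ (V'' : X₀.Opens))) := fun j l => e.inv.app _ (I.subschemeι.app (V'' : X₀.Opens) (N j l)) with hNbdef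
  -- STEP 2: restrict the two links to `Ω`
  have L1 : ((Scheme.Modules.pullback e.inv).obj (conormalSheaf I.subschemeι)).presheaf.map kΩW.op (σ.app W (basisSection κ 0)) = ∑ l, ā l • b l := by
    rw [Subsingleton.elim kΩW (kΩV ≫ homOfLE hVW), op_comp, ((Scheme.Modules.pullback e.inv).obj (conormalSheaf I.subschemeι)).presheaf.map_comp]
    change ((Scheme.Modules.pullback e.inv).obj (conormalSheaf I.subschemeι)).presheaf.map kΩV.op (((Scheme.Modules.pullback e.inv).obj (conormalSheaf I.subschemeι)).presheaf.map (homOfLE hVW).op _) = _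
    rw [hlink, map_sum]
    refine Finset.sum_congr rfl fun l _ => ?_
    rw [Scheme.Modules.map_smul]
  have L2 : ((Scheme.Modules.pullback e.inv).obj (conormalSheaf I.subschemeι)).presheaf.map kΩW'.op (σ.app W' (basisSection κ' 0)) = ∑ l, (∑ j, ā' j * Nb j l) • b l := by
    rw [Subsingleton.elim kΩW' (kΩV' ≫ homOfLE hVW'), op_comp, ((Scheme.Modules.pullback e.inv).obj (conormalSheaf I.subschemeι)).presheaf.map_comp]
    change ((Scheme.Modules.pullback e.inv).obj (conormalSheaf I.subschemeι)).presheaf.map kΩV'.op (((Scheme.Modules.pullback e.inv).obj (conormalSheaf I.subschemeι)).presheaf.map (homOfLE hVW').op _) = _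
    rw [hlink', map_sum]
    have hj : ∀ j, ((Scheme.Modules.pullback e.inv).obj (conormalSheaf I.subschemeι)).presheaf.map kΩV'.op (e.inv.app _ (I.subschemeι.app (V' : X₀.Opens) (A' j)) •
        basisSection (E := (Scheme.Modules.pullback e.inv).obj (conormalSheaf I.subschemeι)) (pullbackFrame e.inv eV') j) = ∑ l, (ā' j * Nb j l) • b l := fun j => by
      rw [Scheme.Modules.map_smul, Subsingleton.elim kΩV' ((Opens.map e.inv.base).map ((Opens.map I.subschemeι.base).map (homOfLE h'))),
        R2 j, Finset.smul_sum]
      refine Finset.sum_congr rfl fun l _ => ?_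
      rw [smul_smul, Subsingleton.elim ((Opens.map e.inv.base).map ((Opens.map I.subschemeι.base).map (homOfLE h))) kΩV,
        Subsingleton.elim ((Opens.map e.inv.base).map ((Opens.map I.subschemeι.base).map (homOfLE h'))) kΩV']
    rw [Finset.sum_congr rfl fun j _ => hj j, Finset.sum_comm]
    refine Finset.sum_congr rfl fun l _ => ?_
    rw [Finset.sum_smul]
  -- STEP 3: the two generators of `K` differ by a unit `t` on `Ω`, and so do their images under `σ`
  set t : Γ(Y, e.inv ⁻¹ᵁ (I.subschemeι ⁻¹ᵁ (V'' : X₀.Opens))) := transition κ κ' kΩW kΩW' 0 0 with htdef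
  set t' : Γ(Y, e.inv ⁻¹ᵁ (I.subschemeι ⁻¹ᵁ (V'' : X₀.Opens))) := transition κ' κ kΩW' kΩW 0 0 with ht'def
  have htt' : t * t' = 1 := P1VB.transition_mul_transition_fin_one κ κ' kΩW kΩW'
  have hK : K.presheaf.map kΩW'.op (basisSection κ' 0) = t • K.presheaf.map kΩW.op (basisSection κ 0) := by
    rw [map_basisSection_eq_sum_transition κ κ' kΩW kΩW' 0, Fin.sum_univ_one]
  have L3 : ((Scheme.Modules.pullback e.inv).obj (conormalSheaf I.subschemeι)).presheaf.map kΩW'.op (σ.app W' (basisSection κ' 0)) = t • ((Scheme.Modules.pullback e.inv).obj (conormalSheaf I.subschemeι)).presheaf.map kΩW.op (σ.app W (basisSection κ 0)) := by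
    have n1 := PresheafOfModules.naturality_apply σ.val kΩW'.op (basisSection κ' 0)
    have n2 := PresheafOfModules.naturality_apply σ.val kΩW.op (basisSection κ 0)
    change σ.app _ (K.presheaf.map kΩW'.op (basisSection κ' 0)) = ((Scheme.Modules.pullback e.inv).obj (conormalSheaf I.subschemeι)).presheaf.map kΩW'.op (σ.app W' (basisSection κ' 0)) at n1
    change σ.app _ (K.presheaf.map kΩW.op (basisSection κ 0)) = ((Scheme.Modules.pullback e.inv).obj (conormalSheaf I.subschemeι)).presheaf.map kΩW.op (σ.app W (basisSection κ 0)) at n2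
    rw [← n1, ← n2, hK, Scheme.Modules.Hom.app_smul]
  -- STEP 4: coordinates in the frame `(b_l)`: `t ā_l = Σ_j ā'_j N̄_jl`
  have hcoef : ∀ l, t * ā l = ∑ j, ā' j * Nb j l := fun l => by
    have h1 := congrArg (fun m => coord (E := (Scheme.Modules.pullback e.inv).obj (conormalSheaf I.subschemeι)) (pullbackFrame e.inv eV) kΩV m l) (L3.symm.trans L2)
    simp only at h1
    rw [L1, Finset.smul_sum] at h1
    simp_rw [smul_smul] at h1
    rw [hbdef] at h1
    simp only at h1
    rw [coord_sum_smul_basisSection, coord_sum_smul_basisSection] at h1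
    exact h1
  -- STEP 5: the ring map `ρ : Γ(V'') → Γ(Ω)` (surjective with kernel `I(V'')`) and the restricted coefficients
  let ρ : Γ(X₀, (V'' : X₀.Opens)) →+* Γ(Y, e.inv ⁻¹ᵁ (I.subschemeι ⁻¹ᵁ (V'' : X₀.Opens))) := ((e.inv ≫ I.subschemeι).app (V'' : X₀.Opens)).hom
  have hρ : ∀ a, ρ a = e.inv.app _ (I.subschemeι.app (V'' : X₀.Opens) a) := fun a => rfl
  have hρsurj : Function.Surjective ρ :=
    (ConcreteCategory.bijective_of_isIso (e.inv.app (I.subschemeι ⁻¹ᵁ (V'' : X₀.Opens)))).2.comp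
      (I.subschemeι_app_surjective V'')
  have hρker : ∀ a, ρ a = 0 → a ∈ I.ideal V'' := by
    intro a ha
    rw [← Scheme.IdealSheafData.ker_subschemeι_app I V'', RingHom.mem_ker]
    rw [hρ] at ha
    exact (ConcreteCategory.bijective_of_isIso (e.inv.app (I.subschemeι ⁻¹ᵁ (V'' : X₀.Opens)))).1
      (by rw [ha, map_zero])
  -- naturality: `ρ (a|_{V''}) = (e⁻¹♯ ι♯ a)|_Ω`
  have hnat : ∀ {U : X₀.affineOpens} (hU : (V'' : X₀.Opens) ≤ U) (kU : e.inv ⁻¹ᵁ (I.subschemeι ⁻¹ᵁ (V'' : X₀.Opens)) ⟶ e.inv ⁻¹ᵁ (I.subschemeι ⁻¹ᵁ (U : X₀.Opens)))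
      (a : Γ(X₀, (U : X₀.Opens))),
      ρ (secRes X₀ hU a) = Y.presheaf.map kU.op (e.inv.app _ (I.subschemeι.app (U : X₀.Opens) a)) := by
    intro U hU kU a
    have n := ConcreteCategory.congr_hom ((e.inv ≫ I.subschemeι).naturality (homOfLE hU).op) a
    simp only [CommRingCat.comp_apply, Quiver.Hom.unop_op] at n
    rw [Subsingleton.elim ((Opens.map (e.inv ≫ I.subschemeι).base).map (homOfLE hU)) kU] at n
    exact n
  have hāρ : ∀ l, ā l = ρ (secRes X₀ h (A l)) := fun l => (hnat h kΩV (A l)).symm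
  have hā'ρ : ∀ j, ā' j = ρ (secRes X₀ h' (A' j)) := fun j => (hnat h' kΩV' (A' j)).symm
  have hNbρ : ∀ j l, Nb j l = ρ (N j l) := fun j l => rfl
  -- STEP 6: lift `t`, `t'` and pull the coordinate identities back to `Γ(V'')` modulo `I(V'')`
  obtain ⟨T, hT⟩ := hρsurj t
  obtain ⟨T', hT'⟩ := hρsurj t'
  have hTT' : T * T' - 1 ∈ I.ideal V'' := hρker _ (by rw [map_sub, map_mul, map_one, hT, hT', htt', sub_self])
  have hTA : ∀ l, (∑ j, secRes X₀ h' (A' j) * N j l) - T * secRes X₀ h (A l) ∈ I.ideal V'' := fun l =>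
    hρker _ (by
      rw [map_sub, map_mul, map_sum, hT, ← hāρ, hcoef l]
      simp_rw [map_mul, ← hā'ρ, ← hNbρ]
      exact sub_self _)
  -- STEP 7: to the stalk at `p`
  set φ : Γ(X₀, (V'' : X₀.Opens)) →+* X₀.presheaf.stalk p := (X₀.presheaf.germ (V'' : X₀.Opens) p hpV'').hom with hφdef
  have hJ : stalkIdeal I p = (I.ideal V'').map φ := stalkIdeal_eq_map_germ I V'' hpV''
  have hJm : stalkIdeal I p ≤ IsLocalRing.maximalIdeal _ := (mem_support_iff_stalkIdeal_le I p).mp hpI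
  have hmemJ : ∀ {a}, a ∈ I.ideal V'' → φ a ∈ stalkIdeal I p := fun ha => by
    rw [hJ]; exact Ideal.mem_map_of_mem _ ha
  have hTunit : IsUnit (φ T) :=
    isUnit_of_mul_sub_one_mem (stalkIdeal I p) hJm (t := φ T) (t' := φ T')
      (by simpa only [map_sub, map_mul, map_one] using hmemJ hTT')
  -- the two germs through `V''`
  have hgerm : X₀.presheaf.germ (V : X₀.Opens) p hp (∑ j, A j * x j) = φ (secRes X₀ h (∑ j, A j * x j)) := by
    rw [hφdef]; exact (X₀.presheaf.germ_res_apply (homOfLE h) p hpV'' _).symm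
  have hgerm' : X₀.presheaf.germ (V' : X₀.Opens) p hp' (∑ j, A' j * x' j) = φ (secRes X₀ h' (∑ j, A' j * x' j)) := by
    rw [hφdef]; exact (X₀.presheaf.germ_res_apply (homOfLE h') p hpV'' _).symm
  -- STEP 8: the ring core
  have hx_mem : ∀ l, secRes X₀ h (x l) ∈ I.ideal V'' := fun l => by
    rw [← I.map_ideal (show V'' ≤ V from h)]
    exact Ideal.mem_map_of_mem _ (hgen ▸ Ideal.subset_span ⟨l, rfl⟩)
  have hc : φ (secRes X₀ h (∑ j, A j * x j)) = ∑ l, φ (secRes X₀ h (A l)) * φ (secRes X₀ h (x l)) := by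
    simp only [map_sum, map_mul]
  have hc' : φ (secRes X₀ h' (∑ j, A' j * x' j)) =
      ∑ l, (∑ j, φ (secRes X₀ h' (A' j)) * φ (N j l)) * φ (secRes X₀ h (x l)) := by
    simp only [map_sum, map_mul]
    simp_rw [hN, map_sum, map_mul, Finset.mul_sum, Finset.sum_mul, mul_assoc]
    rw [Finset.sum_comm]
  rw [hgerm, hgerm', hc, hc', eq_comm]
  refine span_sum_mul_sup_sq_eq (stalkIdeal I p) Finset.univ hTunit (fun l _ => ?_) (fun l _ => hmemJ (hx_mem l))
  have h1 := hmemJ (hTA l)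
  simp only [map_sub, map_mul, map_sum] at h1
  exact h1


end Summit.ResolutionOfSingularities.ResolutionOfSingularities.Cruxes.EquisingularLiftNat.Sections

end
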